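import Summits.AtomisticToContinuum.FouriersLaw.Theorems.BondHeatUncertaintyExtensiveSnapshotIrreversibilityEnergyWindowDivergenceRungs

/-!
# Crux `ExtensiveSnapshotIrreversibility` (stmt-AtomisticToContinuum-9121), fixed-`N` half `K_fix`:
the DIVERGENCE LADDER — A0 ∧ QMD₀ ⟹ ΔSharp (node «DivergenceLadder», 5/6)

(glue file, theorem-side; decomp-a2c lens-1 «grading / quantitative ladder», gen 89.)

* `triangular_le_two_mul_sq_exp_half` — `(eᵃ − eᵇ)²/(eᵃ + eᵇ) ≤ 2 (e^{a/2} − e^{b/2})²`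
  (triangular discrimination ≤ 2 × squared Hellinger integrand);
* `tendsto_mul_integral_mul_sq`, `ae_eq_two_mul_of_halfExp_response` — the response density of a
  normalised exponential family whose half-exponents are `L²`-differentiable (`q_δ → g`) is `2g`:
  `(e^{φ_δ} − 1)/δ = 2 q_δ + δ q_δ²` tested on `C_c^∞` (`ae_eq_of_tendsto_testFunction`);
* `toReal_rnDeriv_ae_eq_exp`, `memLp_halfExp_dq`, `integral_oddSq_eq_four_mul`,
  `integral_triangular_le_two_mul_halfExp_oddSq` — one-state bookkeeping (two exponents of the same
  state agree a.e.; `Δ ≤ 2 ∫ (e^{φ/2} − e^{φ∘Θ/2})²`);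
* ★ `nessFlipTriangularSharp_of_sqrtResponseL2` — **A0 ∧ QMD₀ ⟹ ΔSharp**: `h = 2g` a.e., so
  `½ ∫ (h − h∘Θ)² = 2 ∫ (g − g∘Θ)²`, and `Δ ≤ 2 ∫ (√f_δ − √f_δ∘Θ)² ≤ 2 (K/2) δ²`
  (`eventually_integral_oddSq_le` on the half-exponents `φ_δ/2`);
* `nessFlipTriangularSharp_of_linearResponseL2` — **A0 ∧ A4 ⟹ ΔSharp** (ΔSharp is at most the
  record's A4; the converse is not claimed).

No new objects. [folklore]
-/

noncomputable section

namespace Summit.AtomisticToContinuum.FouriersLaw.Theorems.ExtensiveSnapshotIrreversibility.EnergyWindow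

open MeasureTheory Filter Topology InformationTheory Real
open scoped ENNReal NNReal
open Literature.MathematicalPhysics.KineticTheory.HeatConduction
open Summit.AtomisticToContinuum.FouriersLaw.Theorems.ExtensiveSnapshotIrreversibility.Negative
open Summit.AtomisticToContinuum.FouriersLaw.Theorems.ExtensiveSnapshotIrreversibility.ClausiusBudget.OddLogDensity

variable {N : ℕ}

/-! ## A0 ∧ QMD₀ ⟹ ΔSharp -/

/-- `(eᵃ − eᵇ)²/(eᵃ + eᵇ) ≤ 2 (e^{a/2} − e^{b/2})²` (`(A + B)² ≤ 2(A² + B²)`). [folklore] -/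
theorem triangular_le_two_mul_sq_exp_half (a b : ℝ) :
    (exp a - exp b) ^ 2 / (exp a + exp b) ≤ 2 * (exp (a / 2) - exp (b / 2)) ^ 2 := by
  have hA : exp a = exp (a / 2) ^ 2 := by rw [sq, ← exp_add]; ring_nf
  have hB : exp b = exp (b / 2) ^ 2 := by rw [sq, ← exp_add]; ring_nf
  rw [div_le_iff₀ (by positivity), hA, hB]
  nlinarith [sq_nonneg ((exp (a / 2) - exp (b / 2)) ^ 2), exp_pos (a / 2), exp_pos (b / 2)]

/-- Bounded test × squared response: if `q_δ → g` in `L²(μ₀)` then `δ ∫ F q_δ² dμ₀ → 0` for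
bounded `F` (`|∫ F q²| ≤ |B| ∫ q² ≤ |B| (2 ∫ (q−g)² + 2 ∫ g²)`). [folklore] -/
theorem tendsto_mul_integral_mul_sq (μ₀ : Measure (PhaseSpace N)) {q : ℝ → PhaseSpace N → ℝ}
    {g F : PhaseSpace N → ℝ} {B : ℝ} (hFm : AEStronglyMeasurable F μ₀) (hFB : ∀ x, |F x| ≤ B)
    (hg : MemLp g 2 μ₀) (hq : ∀ᶠ δ in 𝓝[≠] (0 : ℝ), MemLp (q δ) 2 μ₀)
    (hlim : Tendsto (fun δ => ∫ x, (q δ x - g x) ^ 2 ∂μ₀) (𝓝[≠] (0 : ℝ)) (𝓝 0)) :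
    Tendsto (fun δ : ℝ => δ * ∫ x, F x * q δ x ^ 2 ∂μ₀) (𝓝[≠] (0 : ℝ)) (𝓝 0) := by
  set G : ℝ := ∫ x, g x ^ 2 ∂μ₀ with hGdef
  have hg2 : Integrable (fun x => g x ^ 2) μ₀ := hg.integrable_sq
  have hone : ∀ᶠ δ in 𝓝[≠] (0 : ℝ), ∫ x, (q δ x - g x) ^ 2 ∂μ₀ < 1 :=
    hlim.eventually_lt_const zero_lt_one
  have t_abs : Tendsto (fun δ : ℝ => |δ|) (𝓝[≠] (0 : ℝ)) (𝓝 0) := by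
    have h := (continuous_abs.tendsto (0 : ℝ))
    rw [abs_zero] at h
    exact h.mono_left nhdsWithin_le_nhds
  refine squeeze_zero_norm' (a := fun δ => |δ| * (|B| * (2 * 1 + 2 * G))) ?_ ?_
  · filter_upwards [hq, hone] with δ hqδ h1
    have hq2 : Integrable (fun x => q δ x ^ 2) μ₀ := hqδ.integrable_sq
    have hFq2 : Integrable (fun x => F x * q δ x ^ 2) μ₀ :=
      hq2.bdd_mul hFm (ae_of_all _ fun x => by rw [Real.norm_eq_abs]; exact hFB x)
    have he2 : Integrable (fun x => (q δ x - g x) ^ 2) μ₀ := (hqδ.sub hg).integrable_sq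
    have hs2 : Integrable (fun x => 2 * (q δ x - g x) ^ 2 + 2 * g x ^ 2) μ₀ :=
      (he2.const_mul 2).add (hg2.const_mul 2)
    have hq2le : ∫ x, q δ x ^ 2 ∂μ₀ ≤ 2 * 1 + 2 * G := by
      have hpt : ∀ x, q δ x ^ 2 ≤ 2 * (q δ x - g x) ^ 2 + 2 * g x ^ 2 := fun x => by
        nlinarith [sq_nonneg (q δ x - 2 * g x)]
      have he2' : Integrable (fun x => 2 * (q δ x - g x) ^ 2) μ₀ := he2.const_mul 2
      have hg2' : Integrable (fun x => 2 * g x ^ 2) μ₀ := hg2.const_mul 2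
      calc ∫ x, q δ x ^ 2 ∂μ₀ ≤ ∫ x, (2 * (q δ x - g x) ^ 2 + 2 * g x ^ 2) ∂μ₀ :=
            integral_mono hq2 hs2 hpt
        _ = 2 * ∫ x, (q δ x - g x) ^ 2 ∂μ₀ + 2 * G := by
            rw [integral_add he2' hg2', integral_const_mul, integral_const_mul]
        _ ≤ 2 * 1 + 2 * G := by linarith [h1.le]
    have hBq : Integrable (fun x => |B| * q δ x ^ 2) μ₀ := hq2.const_mul |B|
    have habs : |∫ x, F x * q δ x ^ 2 ∂μ₀| ≤ |B| * ∫ x, q δ x ^ 2 ∂μ₀ := by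
      rw [← integral_const_mul]
      refine (abs_integral_le_integral_abs).trans (integral_mono hFq2.abs hBq fun x => ?_)
      show |F x * q δ x ^ 2| ≤ |B| * q δ x ^ 2
      rw [abs_mul, abs_of_nonneg (sq_nonneg (q δ x))]
      exact mul_le_mul_of_nonneg_right ((hFB x).trans (le_abs_self B)) (sq_nonneg _)
    show ‖δ * ∫ x, F x * q δ x ^ 2 ∂μ₀‖ ≤ |δ| * (|B| * (2 * 1 + 2 * G))
    rw [Real.norm_eq_abs, abs_mul]
    exact mul_le_mul_of_nonneg_left
      (habs.trans (mul_le_mul_of_nonneg_left hq2le (abs_nonneg B))) (abs_nonneg δ)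
  · have h := t_abs.mul_const (|B| * (2 * 1 + 2 * G))
    rw [zero_mul] at h
    exact h

/-- **Identification of the response density from the half-exponents.**  If `ν_δ = μ₀.tilted φ_δ`
(normalised) near `δ = 0`, the difference quotients of `ν_δ` tested on `C_c^∞` converge to
`∫ F h dμ₀` with `h ∈ L¹(μ₀)`, and `q_δ := (e^{φ_δ/2} − 1)/δ → g` in `L²(μ₀)`, then `h = 2g`
`μ₀`-a.e. (`(e^{φ_δ} − 1)/δ = 2 q_δ + δ q_δ²`; `ae_eq_of_tendsto_testFunction`). [folklore] -/
theorem ae_eq_two_mul_of_halfExp_response (μ₀ : Measure (PhaseSpace N)) [IsProbabilityMeasure μ₀]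
    {ν : ℝ → Measure (PhaseSpace N)} {φ : ℝ → PhaseSpace N → ℝ} {h g : PhaseSpace N → ℝ}
    (hrep : ∀ᶠ δ in 𝓝[≠] (0 : ℝ), Integrable (fun x => exp (φ δ x)) μ₀ ∧
      ∫ x, exp (φ δ x) ∂μ₀ = 1 ∧ ν δ = μ₀.tilted (φ δ))
    (hh : Integrable h μ₀)
    (hhlim : ∀ F : PhaseSpace N → ℝ, ContDiff ℝ ((⊤ : ℕ∞) : WithTop ℕ∞) F → HasCompactSupport F →
      Tendsto (fun δ : ℝ => ((∫ x, F x ∂(ν δ)) - ∫ x, F x ∂μ₀) / δ) (𝓝[≠] (0 : ℝ))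
        (𝓝 (∫ x, F x * h x ∂μ₀)))
    (hg : MemLp g 2 μ₀)
    (hq : ∀ᶠ δ in 𝓝[≠] (0 : ℝ), MemLp (fun x => (exp (φ δ x / 2) - 1) / δ) 2 μ₀)
    (hlim : Tendsto (fun δ => ∫ x, ((exp (φ δ x / 2) - 1) / δ - g x) ^ 2 ∂μ₀)
      (𝓝[≠] (0 : ℝ)) (𝓝 0)) :
    h =ᵐ[μ₀] fun x => 2 * g x := by
  refine ae_eq_of_tendsto_testFunction hh ((hg.const_mul 2).integrable one_le_two)
    (Q := fun F δ => ((∫ x, F x ∂(ν δ)) - ∫ x, F x ∂μ₀) / δ) hhlim ?_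
  intro F hF hFc
  obtain ⟨B, hB⟩ := hF.continuous.bounded_above_of_compact_support hFc
  have hFm : AEStronglyMeasurable F μ₀ := hF.continuous.aestronglyMeasurable
  have hFB : ∀ x, |F x| ≤ B := fun x => by rw [← Real.norm_eq_abs]; exact hB x
  have hFi : Integrable F μ₀ := hF.continuous.integrable_of_hasCompactSupport hFc
  have hlimF := tendsto_integral_mul_of_tendsto_integral_sq
    (q := fun δ x => (exp (φ δ x / 2) - 1) / δ) hFm hFB hg hq hlim
  have hbd := tendsto_mul_integral_mul_sq μ₀ (q := fun δ x => (exp (φ δ x / 2) - 1) / δ)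
    hFm hFB hg hq hlim
  have hsum := (hlimF.const_mul 2).add hbd
  have e2 : 2 * ∫ x, F x * g x ∂μ₀ + 0 = ∫ x, F x * (2 * g x) ∂μ₀ := by
    rw [add_zero, ← integral_const_mul]
    refine integral_congr_ae (ae_of_all _ fun x => ?_)
    ring
  rw [e2] at hsum
  refine hsum.congr' ?_
  filter_upwards [hrep, hq, self_mem_nhdsWithin] with δ hδr hqδ hδ0
  obtain ⟨hi, hz1, htilt⟩ := hδr
  replace hδ0 : δ ≠ 0 := hδ0
  have hFei : Integrable (fun x => F x * exp (φ δ x)) μ₀ :=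
    hi.bdd_mul hFm (ae_of_all _ fun x => hB x)
  have hint : ∫ x, F x ∂(ν δ) = ∫ x, F x * exp (φ δ x) ∂μ₀ := by
    rw [htilt, integral_tilted]
    refine integral_congr_ae (ae_of_all _ fun x => ?_)
    simp only [hz1, div_one, smul_eq_mul]
    ring
  have hFq : Integrable (fun x => 2 * (F x * ((exp (φ δ x / 2) - 1) / δ))) μ₀ :=
    ((hqδ.integrable one_le_two).bdd_mul hFm (ae_of_all _ fun x => hB x)).const_mul 2
  have hFq2 : Integrable (fun x => δ * (F x * ((exp (φ δ x / 2) - 1) / δ) ^ 2)) μ₀ :=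
    (hqδ.integrable_sq.bdd_mul hFm (ae_of_all _ fun x => hB x)).const_mul δ
  show 2 * ∫ x, F x * ((exp (φ δ x / 2) - 1) / δ) ∂μ₀ +
      δ * ∫ x, F x * ((exp (φ δ x / 2) - 1) / δ) ^ 2 ∂μ₀ =
    ((∫ x, F x ∂(ν δ)) - ∫ x, F x ∂μ₀) / δ
  rw [hint, ← integral_sub hFei hFi, ← integral_div, ← integral_const_mul, ← integral_const_mul,
    ← integral_add hFq hFq2]
  refine integral_congr_ae (ae_of_all _ fun x => ?_)
  show 2 * (F x * ((exp (φ δ x / 2) - 1) / δ)) + δ * (F x * ((exp (φ δ x / 2) - 1) / δ) ^ 2) =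
    (F x * exp (φ δ x) - F x) / δ
  have hs : exp (φ δ x) = exp (φ δ x / 2) ^ 2 := by rw [sq, ← exp_add]; ring_nf
  rw [hs]
  field_simp
  ring

/-- `dν/dμ₀ = e^{φ₀}` a.e. for a Gibbs reweighting `ν = e^{φ₀} μ₀`. [folklore] -/
theorem toReal_rnDeriv_ae_eq_exp (μ₀ : Measure (PhaseSpace N)) [SigmaFinite μ₀]
    {ν : Measure (PhaseSpace N)} {φ₀ : PhaseSpace N → ℝ} (hφm : Measurable φ₀)
    (hν : ν = μ₀.withDensity (fun x => ENNReal.ofReal (exp (φ₀ x)))) :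
    (fun x => ((ν.rnDeriv μ₀) x).toReal) =ᵐ[μ₀] fun x => exp (φ₀ x) := by
  have hmeas : Measurable fun x => ENNReal.ofReal (exp (φ₀ x)) := hφm.exp.ennreal_ofReal
  have hd := Measure.rnDeriv_withDensity μ₀ hmeas
  rw [← hν] at hd
  filter_upwards [hd] with x hx
  rw [hx, ENNReal.toReal_ofReal (exp_pos _).le]

/-- The half-exponent difference quotient `(e^{φ₀/2} − 1)/δ` is in `L²(μ₀)` once `e^{φ₀} ∈ L¹(μ₀)`.
[folklore] -/
theorem memLp_halfExp_dq (μ₀ : Measure (PhaseSpace N)) [IsFiniteMeasure μ₀]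
    {φ₀ : PhaseSpace N → ℝ} (hφm : Measurable φ₀) (hi : Integrable (fun x => exp (φ₀ x)) μ₀)
    (δ : ℝ) : MemLp (fun x => (exp (φ₀ x / 2) - 1) / δ) 2 μ₀ := by
  have hhalf : MemLp (fun x => exp (φ₀ x / 2)) 2 μ₀ := by
    rw [memLp_two_iff_integrable_sq (hφm.div_const 2).exp.aestronglyMeasurable]
    refine hi.congr (ae_of_all _ fun x => ?_)
    show exp (φ₀ x) = exp (φ₀ x / 2) ^ 2
    rw [sq, ← exp_add]
    ring_nf
  refine MemLp.ae_eq (ae_of_all _ fun x => ?_) ((hhalf.sub (memLp_const 1)).const_mul (1 / δ))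
  simp only [Pi.sub_apply]
  ring

/-- `∫ (h − h∘Θ)² dμ₀ = 4 ∫ (g − g∘Θ)² dμ₀` when `h = 2g` a.e. and `Θ_* μ₀ = μ₀`. [folklore] -/
theorem integral_oddSq_eq_four_mul (μ₀ : Measure (PhaseSpace N))
    (hinv : μ₀.map (fun x : PhaseSpace N => (x.1, -x.2)) = μ₀) {h g : PhaseSpace N → ℝ}
    (hae : h =ᵐ[μ₀] fun x => 2 * g x) :
    ∫ x, (h x - h (x.1, -x.2)) ^ 2 ∂μ₀ = 4 * ∫ x, (g x - g (x.1, -x.2)) ^ 2 ∂μ₀ := by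
  have hmp : MeasurePreserving (momentumReversal N) μ₀ μ₀ := ⟨(momentumReversal N).measurable, hinv⟩
  have haeΘ : (fun x : PhaseSpace N => h (x.1, -x.2)) =ᵐ[μ₀] fun x => 2 * g (x.1, -x.2) :=
    hmp.quasiMeasurePreserving.ae_eq_comp hae
  rw [← integral_const_mul]
  refine integral_congr_ae ?_
  filter_upwards [hae, haeΘ] with x hx hxΘ
  rw [hx, hxΘ]
  ring

/-- **Triangular discrimination of any representation ≤ twice the half-exponent odd square.**
If `ν = e^{φ₀} μ₀ = e^{φ'} μ₀` (two measurable exponents of the same state) then `φ' = φ₀` a.e. and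
`∫ (e^{φ'} − e^{φ'∘Θ})²/(e^{φ'} + e^{φ'∘Θ}) dμ₀ ≤ 2 ∫ (e^{φ₀/2} − e^{φ₀∘Θ/2})² dμ₀`. [folklore] -/
theorem integral_triangular_le_two_mul_halfExp_oddSq (μ₀ : Measure (PhaseSpace N))
    [IsProbabilityMeasure μ₀] (hinv : μ₀.map (fun x : PhaseSpace N => (x.1, -x.2)) = μ₀)
    {ν : Measure (PhaseSpace N)} {φ₀ φ' : PhaseSpace N → ℝ} (hφ₀m : Measurable φ₀)
    (hφ'm : Measurable φ') (hν₀ : ν = μ₀.withDensity (fun x => ENNReal.ofReal (exp (φ₀ x))))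
    (hν' : ν = μ₀.withDensity (fun x => ENNReal.ofReal (exp (φ' x))))
    (hi : Integrable (fun x => exp (φ₀ x)) μ₀)
    (hodd : Integrable (fun x => (exp (φ₀ x / 2) - exp (φ₀ (x.1, -x.2) / 2)) ^ 2) μ₀) :
    ∫ x, (exp (φ' x) - exp (φ' (x.1, -x.2))) ^ 2 / (exp (φ' x) + exp (φ' (x.1, -x.2))) ∂μ₀ ≤
      2 * ∫ x, (exp (φ₀ x / 2) - exp (φ₀ (x.1, -x.2) / 2)) ^ 2 ∂μ₀ := by
  have hmp : MeasurePreserving (momentumReversal N) μ₀ μ₀ := ⟨(momentumReversal N).measurable, hinv⟩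
  have hae' : (fun x => exp (φ' x)) =ᵐ[μ₀] fun x => exp (φ₀ x) := by
    filter_upwards [toReal_rnDeriv_ae_eq_exp μ₀ hφ'm hν', toReal_rnDeriv_ae_eq_exp μ₀ hφ₀m hν₀]
      with x hx hx0
    rw [← hx, hx0]
  have hae'Θ : (fun x : PhaseSpace N => exp (φ' (x.1, -x.2))) =ᵐ[μ₀]
      fun x => exp (φ₀ (x.1, -x.2)) := hmp.quasiMeasurePreserving.ae_eq_comp hae'
  have hIodd : Integrable (fun x => 2 * (exp (φ₀ x / 2) - exp (φ₀ (x.1, -x.2) / 2)) ^ 2) μ₀ :=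
    hodd.const_mul 2
  rw [← integral_const_mul]
  calc ∫ x, (exp (φ' x) - exp (φ' (x.1, -x.2))) ^ 2 / (exp (φ' x) + exp (φ' (x.1, -x.2))) ∂μ₀
      = ∫ x, (exp (φ₀ x) - exp (φ₀ (x.1, -x.2))) ^ 2 /
          (exp (φ₀ x) + exp (φ₀ (x.1, -x.2))) ∂μ₀ := by
        refine integral_congr_ae ?_
        filter_upwards [hae', hae'Θ] with x hx hxΘ
        rw [hx, hxΘ]
    _ ≤ ∫ x, 2 * (exp (φ₀ x / 2) - exp (φ₀ (x.1, -x.2) / 2)) ^ 2 ∂μ₀ :=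
        integral_mono (integrable_triangular μ₀ hinv hφ₀m hi) hIodd fun x =>
          triangular_le_two_mul_sq_exp_half _ _

/-- ★ **A0 ∧ QMD₀ ⟹ ΔSharp.**  With the A0 exponents `φ_δ` (`dμ_δ/dμ_T = e^{φ_δ}` a.e.,
`Measure.rnDeriv_withDensity`), `q_δ := (e^{φ_δ/2} − 1)/δ → g` in `L²(μ_T)`; the item's response
density is `h = 2g` a.e. (`ae_eq_two_mul_of_halfExp_response`), so
`½ ∫ (h − h∘Θ)² = 2 ∫ (g − g∘Θ)²`;
any representation `φ` at `δ` agrees with `φ_δ` a.e., and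
`Δ ≤ 2 ∫ (e^{φ_δ/2} − e^{φ_δ∘Θ/2})² ≤ 2 (K/2) δ²` (`eventually_integral_oddSq_le`). [folklore] -/
theorem nessFlipTriangularSharp_of_sqrtResponseL2 (h0 : NessGibbsReweighting)
    (hQ : NessSqrtResponseL2) : NessFlipTriangularSharp := by
  intro ω₂ lam β γ hω₂ hlam hβ hγ hU μ hμ T hT N hN h hh K hK
  obtain ⟨φ, hφm, hW0⟩ := h0 ω₂ lam β γ hω₂ hlam hβ hγ hU μ hμ T hT N hN
  obtain ⟨g, hg, hlim⟩ := hQ ω₂ lam β γ hω₂ hlam hβ hγ hU μ hμ T hT N hN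
  set P := pinnedChain ω₂ lam β γ with hP
  set μT := P.gibbsMeasure N T with hμT
  haveI hprob : IsProbabilityMeasure μT :=
    pinnedChain_isProbabilityMeasure_gibbsMeasure hω₂ hlam.le hβ.le γ N hT
  have hG : μ N T T = μT :=
    hU N T T hT hT _ _ (hμ N T T hT hT)
      (pinnedChain_isSteadyState_gibbsMeasure hω₂ hlam.le hβ.le γ N hT)
  have hinv : μT.map (fun x : PhaseSpace N => (x.1, -x.2)) = μT := gibbsMeasure_map_flip P N T
  have h2T : (0 : ℝ) < 2 * T := by positivity
  have hev : ∀ᶠ δ in 𝓝[≠] (0 : ℝ), δ ≠ 0 ∧ |δ| < 2 * T := eventually_ne_and_abs_lt h2T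
  have hevT : ∀ᶠ δ in 𝓝[≠] (0 : ℝ), 0 < T + δ / 2 ∧ 0 < T - δ / 2 := eventually_bath_temps_pos hT
  have hrep' : ∀ᶠ δ in 𝓝[≠] (0 : ℝ), Integrable (fun x => exp (φ δ x)) μT ∧
      ∫ x, exp (φ δ x) ∂μT = 1 ∧ μ N (T + δ / 2) (T - δ / 2) = μT.tilted (φ δ) := by
    filter_upwards [hev, hevT] with δ hδ hδT
    haveI : IsProbabilityMeasure (μ N (T + δ / 2) (T - δ / 2)) := (hμ N _ _ hδT.1 hδT.2).1
    exact tilted_of_withDensity_exp (hφm δ) (hW0 δ hδ.2)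
  -- the half-exponents are `L²`-differentiable with derivative `g`
  have hq' : ∀ᶠ δ in 𝓝[≠] (0 : ℝ), MemLp (fun x => (exp (φ δ x / 2) - 1) / δ) 2 μT := by
    filter_upwards [hrep'] with δ hδr
    exact memLp_halfExp_dq μT (hφm δ) hδr.1 δ
  have hlim' : Tendsto (fun δ => ∫ x, ((exp (φ δ x / 2) - 1) / δ - g x) ^ 2 ∂μT)
      (𝓝[≠] (0 : ℝ)) (𝓝 0) := by
    refine hlim.congr' ?_
    filter_upwards [hev] with δ hδ
    refine integral_congr_ae ?_
    filter_upwards [toReal_rnDeriv_ae_eq_exp μT (hφm δ) (hW0 δ hδ.2)] with x hx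
    rw [hx, ← Real.exp_half]
  have hodd := eventually_integral_oddSq_le (φ := fun δ x => φ δ x / 2) hinv hg hq' hlim'
  -- identification `h = 2g` a.e.
  have hh1 : Integrable h μT := by
    have hm2 : MemLp h 2 (μ N T T) := hh.1
    rw [hG] at hm2
    exact hm2.integrable one_le_two
  have hhlim : ∀ F : PhaseSpace N → ℝ, ContDiff ℝ ((⊤ : ℕ∞) : WithTop ℕ∞) F →
      HasCompactSupport F → Tendsto (fun δ : ℝ => ((∫ x, F x ∂(μ N (T + δ / 2) (T - δ / 2))) -
        ∫ x, F x ∂μT) / δ) (𝓝[≠] (0 : ℝ)) (𝓝 (∫ x, F x * h x ∂μT)) := by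
    intro F hF hFc
    have h2 := hh.2.1 F hF hFc
    rw [hG] at h2
    exact h2
  have hae : h =ᵐ[μT] fun x => 2 * g x :=
    ae_eq_two_mul_of_halfExp_response μT (ν := fun δ => μ N (T + δ / 2) (T - δ / 2))
      hrep' hh1 hhlim hg hq' hlim'
  -- the threshold: `½ ∫ (h − h∘Θ)² dμ_{N,T,T} = 2 ∫ (g − g∘Θ)² dμ_T`
  have hDK : ∫ x, (g x - g (x.1, -x.2)) ^ 2 ∂μT < K / 2 := by
    rw [hG, integral_oddSq_eq_four_mul μT hinv hae] at hK
    linarith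
  filter_upwards [hodd (K / 2) hDK, hev, hrep'] with δ hδodd hδ hδr φ' hφ'm hφ'rep
  calc ∫ x, (exp (φ' x) - exp (φ' (x.1, -x.2))) ^ 2 / (exp (φ' x) + exp (φ' (x.1, -x.2))) ∂μT
      ≤ 2 * ∫ x, (exp (φ δ x / 2) - exp (φ δ (x.1, -x.2) / 2)) ^ 2 ∂μT :=
        integral_triangular_le_two_mul_halfExp_oddSq μT hinv (hφm δ) hφ'm (hW0 δ hδ.2) hφ'rep
          hδr.1 hδodd.1
    _ ≤ 2 * (K / 2 * δ ^ 2) := mul_le_mul_of_nonneg_left hδodd.2 zero_le_two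
    _ = K * δ ^ 2 := by ring

/-- **A0 ∧ A4 ⟹ ΔSharp**: the record's response atom gives the divergence atom (the converse is not
claimed — ΔSharp asks no second `L²(μ_T)` moment of the response). [folklore] -/
theorem nessFlipTriangularSharp_of_linearResponseL2 (h0 : NessGibbsReweighting)
    (h4 : NessLinearResponseL2) : NessFlipTriangularSharp :=
  nessFlipTriangularSharp_of_sqrtResponseL2 h0 (nessSqrtResponseL2_of_linearResponseL2 h4)

end Summit.AtomisticToContinuum.FouriersLaw.Theorems.ExtensiveSnapshotIrreversibility.EnergyWindow

end
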